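import Summits.BirchSwinnertonDyer.BirchSwinnertonDyer.Theses.ResidualThetaTransportAtTwo
import Summits.BirchSwinnertonDyer.BirchSwinnertonDyer.Theorems.ResidualThetaTransportAtTwoSignedMuVanishingAtTwoPlusSel2
import Summits.BirchSwinnertonDyer.BirchSwinnertonDyer.Theorems.ThetaPartnerAtTwoSignedTransportAtTwoStubSel2F
import Summits.BirchSwinnertonDyer.BirchSwinnertonDyer.Theorems.ThetaPartnerAtTwoSignedTransportAtTwoStubSel2U
import HarnessLib

/-!
# Crux `SignedMuSeedAtTwoPlus` (stmt-BirchSwinnertonDyer-21438), line `norm-one-torus` (crux-ideate k=1, round 1, gen 2)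

SKELETON. The seed «some member `A` of the mod-2 class of a habitat⁺ curve `W` has `Sel⁺(A/ℚ_∞)[2]` finite» is
attacked MEMBER-FREE, through the PRIMITIVE residual signed-plus module of `ρ̄ = W[2]` over `ℚ_∞`
(`primResidualPlus`: classes unramified at EVERY odd place, residually trivial at `∞`, signed-plus at `2`; no bad
prime of any member enters). By `𝔽₂[S₃/C₂] = 𝟙 ⊕ ρ̄` its layers are Kummer / unit / class-group data of the cubic
tower `L_W · ℚ_n` (`L_W = ℚ(W[2])⁺` the 2-division cubic field) cut by ONE universal 2-adic line (Honda: all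
`a₂ = 0` supersingular formal groups over `ℤ₂` are isomorphic) — the 2-Selmer arithmetic of the norm-one torus
`R¹_{L_W/ℚ} 𝔾_m`. Stubs: S1 tower gap for the primitive module (a count `#R[T^q] < 2^q` at ONE `q` forces `R` finite;
`T = conj_γ − 1` is locally nilpotent by `exists_conjH1_pow_prime_pow_eq`), S2 primitive-to-member (GV §2 imprimitive
finiteness `stub_sel2F` + containment `stub_sel2U` for `A := W`), S3 the per-class certificate (conjecture-strength as a
`∀`; per class `q = 1` is a UNIT TEST in `L_W`: `h(L_W)` odd and the fundamental unit off the universal plus-line).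
BSD is not proved by this; every `stub_*` is open here (S1, S2 are M-sized Galois-cohomology lemmas).
-/

set_option autoImplicit false
set_option linter.dupNamespace false

noncomputable section

open scoped Classical AddSubgroup

open WeierstrassCurve NumberField IsDedekindDomain Literature Literature.NumberTheory.EllipticCurves
  Literature.NumberTheory.GaloisRepresentations Literature.NumberTheory.EllipticCurves.GreenbergVatsal2000
  Literature.NumberTheory.EllipticCurves.Kobayashi2003 ZpExtension
  Literature.NumberTheory.EllipticCurves.GreenbergSelmer
  Literature.NumberTheory.EllipticCurves.Rank1Residual Literature.NumberTheory.EllipticCurves.IwasawaAlgebra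
  Summit.BirchSwinnertonDyer.BirchSwinnertonDyer.Theses.ResidualThetaTransportAtTwo
  Summit.BirchSwinnertonDyer.BirchSwinnertonDyer.Theorems.SignedTransportAtTwo

namespace Summit.BirchSwinnertonDyer.BirchSwinnertonDyer.Cruxes.SignedMuSeedAtTwoPlus.NormOneTorus

/-- The PRIMITIVE residual signed-plus set of `W[2]` over `ℚ_∞ = ℚ̄^{ker κ}`: classes `c ∈ H¹(ℚ_∞, W[2^∞][2])` that are
(a) unramified at EVERY odd place (`S₀ = ∅`), (b) residually trivial at the real places, (c) signed-plus at the place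
above `2` (Kummer image of `⨆ₙ E⁺(ℚ_{n,2})`). It depends only on `ρ̄ = W[2]` and the universal supersingular local
condition (class invariant); it is the `S₀ = ∅` instance of the set of `SignedTransportAtTwo.stub_sel2F`.
[cite: GreenbergVatsal2000, §2 pp. 17, 21] [cite: Kobayashi2003, Def. 1.1] -/
def primResidualPlus (W : WeierstrassCurve ℚ) [W.IsElliptic] (κ : ZpExtension ℚ 2) :
    Set (subgroupH1 κ.kerSubgroup ↥((↥(W.geomPrimaryTorsion 2))[(2 : ℤ)])) :=
  {c | c ∈ unramifiedOutside κ.kerSubgroup ↥((↥(W.geomPrimaryTorsion 2))[(2 : ℤ)]) 2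
          (∅ : Set (HeightOneSpectrum (𝓞 ℚ))) ∧
        (∀ (w : InfinitePlace ℚ) (σ : Field.absoluteGaloisGroup ℚ),
          Literature.NumberTheory.EllipticCurves.conjH1 κ.kerSubgroup ↥((↥(W.geomPrimaryTorsion 2))[(2 : ℤ)]) σ c ∈
            GreenbergSelmer.infKer κ.kerSubgroup ↥((↥(W.geomPrimaryTorsion 2))[(2 : ℤ)]) w) ∧
        (∀ (v : HeightOneSpectrum (𝓞 ℚ)), ((2 : ℕ) : 𝓞 ℚ) ∈ v.asIdeal → ∀ σ : Field.absoluteGaloisGroup ℚ,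
          W.conjH1 2 κ.kerSubgroup σ
              (pushH1 κ.kerSubgroup ((↥(W.geomPrimaryTorsion 2))[(2 : ℤ)]).subtype (subtype_torsionBy_smul W 2) c) ∈
            localKummerOverOfEmb W 2 κ.kerSubgroup (closureEmb (K := ℚ) (v.adicCompletion ℚ))
              (⨆ n : ℕ, signedLocalPoints κ (v.adicCompletion ℚ) W 1 n))}

/-- `conj_γ` on `H¹(ℚ_∞, W[2^∞][2])` as an element of the endomorphism ring (so that `T = conj_γ − 1`, the
`𝔽₂⟦T⟧`-variable of the residual module, and its powers are available). [cite: GreenbergLNM1716, §1] -/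
def residualConj (W : WeierstrassCurve ℚ) [W.IsElliptic] (κ : ZpExtension ℚ 2) (γ : Field.absoluteGaloisGroup ℚ) :
    AddMonoid.End (subgroupH1 κ.kerSubgroup ↥((↥(W.geomPrimaryTorsion 2))[(2 : ℤ)])) :=
  Literature.NumberTheory.EllipticCurves.conjH1 κ.kerSubgroup ↥((↥(W.geomPrimaryTorsion 2))[(2 : ℤ)]) γ

/-- **The member-free layer certificate at exponent `q`**: the `T^q`-torsion of the primitive residual plus module is
a finite set of FEWER than `2^q` classes. For `q = 2^n` this is the primitive residual plus-Selmer group over `ℚ_n`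
(unit / class-group data of `L_W·ℚ_n` cut by the universal plus-line); `q = 1` says it is `{0}` — ONE UNIT TEST in the
cubic field `L_W`. [cite: GreenbergVatsal2000, §2] [cite: Cassels1991LMSST, §15] -/
def PrimCertificate (W : WeierstrassCurve ℚ) [W.IsElliptic] (κ : ZpExtension ℚ 2)
    (γ : Field.absoluteGaloisGroup ℚ) (q : ℕ) : Prop :=
  ∃ F : Finset (subgroupH1 κ.kerSubgroup ↥((↥(W.geomPrimaryTorsion 2))[(2 : ℤ)])),
    (∀ c, c ∈ F ↔ (c ∈ primResidualPlus W κ ∧ ((residualConj W κ γ - 1) ^ q) c = 0)) ∧ F.card < 2 ^ q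

/-- **S1 · stub_primTowerGap** (Ω-algebra of the primitive module; M). `R = primResidualPlus W κ` is an additive
subgroup stable under `T = conj_γ − 1`, `2R = 0`, and `T` is locally nilpotent on it (`(γ^{2^a} − 1) c = 0` for `c`
from layer `a`: `exists_conjH1_pow_prime_pow_eq`, char `2`). If `#R[T^q] < 2^q` for one `q ≥ 1`, then in the chain
`0 = R[T^0] ⊆ R[T] ⊆ ⋯ ⊆ R[T^q]` some step is improper, the chain stabilises there, and `R = ⋃ R[T^i] = R[T^q]` is finite
(tower-gap lemma, the member-free twin of `LayerRank.finite_quotient_augIdealP_of_card_layer_lt`).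
[cite: Fukuda1994, Thm. 1] [cite: Washington1997, §13.2] -/
theorem stub_primTowerGap :
    ∀ (W : WeierstrassCurve ℚ) [W.IsElliptic] (κ : ZpExtension ℚ 2) (γ : Field.absoluteGaloisGroup ℚ),
      κ.IsCyclotomic → κ.IsTopGenerator γ → ∀ q : ℕ, 1 ≤ q → PrimCertificate W κ γ q →
      (primResidualPlus W κ).Finite := by
  sorry

/-- **S2 · stub_primToSel2** (primitive ⇒ member, `A := W`; M). If the primitive residual plus module is finite then
`Sel⁺(W/ℚ_∞)[2]` is finite: (i) imprimitive finiteness at `S₀ = bad(W)` from primitive finiteness (the detecting map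
into the finite `∏ H¹(I_w, W[2])`, `SignedTransportAtTwo.stub_sel2F` with its CM decorations dropped), (ii) every class of
`Sel⁺(W/ℚ_∞)[2] = image of H¹(ℚ_∞, W[2]) ∩ Sel⁺` lands in the imprimitive set (`stub_sel2U`: halving unramified at good
odd places, `Δ_W < 0` ⇒ trivial at `∞`, signed condition at `2`), (iii) `H¹(ℚ_∞, W[2]) → H¹(ℚ_∞, W[2^∞])[2]` is
bijective as `W(ℚ_∞)[2] = 0` (`ρ̄` irreducible with image `S₃`). [cite: GreenbergVatsal2000, Prop. (2.8)] [cite: BDKim2009, Prop. 2.10] -/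
theorem stub_primToSel2 :
    ∀ (W : WeierstrassCurve ℚ) [W.IsElliptic] [W.IsGloballyMinimal], ¬ W.HasCM → GoodSS W 2 → W.frobeniusTrace 2 = 0 →
      W.Δ < 0 → ∀ (κ : ZpExtension ℚ 2), κ.IsCyclotomic → (primResidualPlus W κ).Finite →
      {s : signedSelmerInfty W κ 1 | 2 • s = 0}.Finite := by
  sorry

/-- **S3 · stub_primCertificate** (the per-class CERTIFICATE; conjecture-strength as a `∀`, COMPLETE: equivalent to the
residual seed by S1 and the structure of discrete `𝔽₂⟦T⟧`-modules). Per class it is discharged by ONE finite computation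
in the cubic tower: `q = 1` ⟺ `h(L_W)` odd ∧ the norm-`+1` fundamental unit `ε` of `L_W` is neither a square nor on the
universal plus-line in `ℚ₂(∛2)^×/□` (no descent on any curve; no Tamagawa number, no `Ш`); `q = 2, 4` = the same test
in `L_W(√2)`, `L_W(√(2+√2))`. Why it might fail: classes with `h(L_W)` even need `q ≥ 2`; positive residual `μ` of `ρ̄`
would kill every `q` (none known for irreducible `ρ̄` at `2`: Greenberg Prop. 5.13 / Kramer 1999 need a rational cyclic
2-power isogeny). [cite: Kramer1999, §1] [cite: Schneiders1997, Thm. 1] -/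
theorem stub_primCertificate :
    ∀ (W : WeierstrassCurve ℚ) [W.IsElliptic] [W.IsGloballyMinimal], ¬ W.HasCM → W.analyticRank = 0 →
      GoodSS W 2 → W.frobeniusTrace 2 = 0 → W.Δ < 0 →
      ∀ (κ : ZpExtension ℚ 2) (γ : Field.absoluteGaloisGroup ℚ), κ.IsCyclotomic → κ.IsTopGenerator γ →
      ∃ q : ℕ, 1 ≤ q ∧ PrimCertificate W κ γ q := by
  sorry

/-- **Composition (kernel-checked)**: S1 → S2 → S3 → the crux BY NAME, through the landed door
`SignedMuAtTwo.signedMuSeedAtTwoPlus_of_sel2Seed` with `A := W` and the identity of `W[2]`. -/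
theorem SignedMuSeedAtTwoPlus_of :
    (∀ (W : WeierstrassCurve ℚ) [W.IsElliptic] (κ : ZpExtension ℚ 2) (γ : Field.absoluteGaloisGroup ℚ),
      κ.IsCyclotomic → κ.IsTopGenerator γ → ∀ q : ℕ, 1 ≤ q → PrimCertificate W κ γ q →
      (primResidualPlus W κ).Finite) →
    (∀ (W : WeierstrassCurve ℚ) [W.IsElliptic] [W.IsGloballyMinimal], ¬ W.HasCM → GoodSS W 2 → W.frobeniusTrace 2 = 0 →
      W.Δ < 0 → ∀ (κ : ZpExtension ℚ 2), κ.IsCyclotomic → (primResidualPlus W κ).Finite →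
      {s : signedSelmerInfty W κ 1 | 2 • s = 0}.Finite) →
    (∀ (W : WeierstrassCurve ℚ) [W.IsElliptic] [W.IsGloballyMinimal], ¬ W.HasCM → W.analyticRank = 0 →
      GoodSS W 2 → W.frobeniusTrace 2 = 0 → W.Δ < 0 →
      ∀ (κ : ZpExtension ℚ 2) (γ : Field.absoluteGaloisGroup ℚ), κ.IsCyclotomic → κ.IsTopGenerator γ →
      ∃ q : ℕ, 1 ≤ q ∧ PrimCertificate W κ γ q) →
    SignedMuSeedAtTwoPlus := by
  intro h1 h2 h3
  apply Summit.BirchSwinnertonDyer.BirchSwinnertonDyer.Theorems.SignedMuAtTwo.signedMuSeedAtTwoPlus_of_sel2Seed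
  intro W _ _ hCM hr hss ha2 hΔ
  refine ⟨W, ‹_›, ‹_›, hss, ha2, ⟨AddEquiv.refl _, fun _ _ ↦ rfl⟩, ?_⟩
  intro κ γ hκ hγ _hD
  obtain ⟨q, hq, hc⟩ := h3 W hCM hr hss ha2 hΔ κ γ hκ hγ
  exact h2 W hCM hss ha2 hΔ κ hκ (h1 W κ γ hκ hγ q hq hc)

/-- The composition instantiated at the registered stubs. -/
theorem SignedMuSeedAtTwoPlus_of_stubs : SignedMuSeedAtTwoPlus :=
  SignedMuSeedAtTwoPlus_of stub_primTowerGap stub_primToSel2 stub_primCertificate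

end Summit.BirchSwinnertonDyer.BirchSwinnertonDyer.Cruxes.SignedMuSeedAtTwoPlus.NormOneTorus

end
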